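import Literature.Computability.Complexity.Algebrization
import Literature.Computability.Complexity.Oracle
import Literature.Computability.Cryptography.ClassBQP
import HarnessLib

/-!
# Algebrization barriers for `BQP` versus `BPP` (Aaronson–Wigderson)

Topic `Literature/Computability/Complexity` (fact item `wi-03598`; companion to
`Algebrization.lean`; routes `CircuitLB`, `Shor`).

Aaronson–Wigderson (2009), Def. 2.3: an inclusion `C ⊆ D` *algebrizes* if `C^A ⊆ D^Ã` for all
oracle languages `A` and all low-degree extensions `Ã`; proving `C ⊆ D` *requires non-algebrizing
techniques* if there are `A, Ã` with `C^A ⊄ D^Ã`. A separation `C ⊄ D` algebrizes if `C^Ã ⊄ D^A`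
for all `A, Ã`; proving `C ⊄ D` requires non-algebrizing techniques if there are `A, Ã` with
`C^Ã ⊆ D^A`. For quantum versus classical polynomial time both directions are barred:

* `aaronsonWigderson2009_bqp_not_subset_bpp` — **AW Thm 5.11 (iv)**: there are `A` and its
  multilinear extension `Ã` with `BQP^A ⊄ BPP^Ã`; hence *proving `BPP = BQP` requires
  non-algebrizing techniques* (AW §1.3). Typed with the library's `BQPRel A` (Boolean oracle
  language, `ClassBQP.lean`) and `BPPRel Ã.toOracle` (`Oracle.lean`, `Algebrization.lean`).
* `aaronsonWigderson2009_bqp_subset_bpp_collapse` — the collapse direction (**AW Thm 5.1/5.2**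
  argument, `A` `PSPACE`-complete, `Ã` its multilinear extension, which is again
  `PSPACE`-computable (Babai–Fortnow–Lund), so `C^Ã ⊆ PSPACE^{Ã[poly]} = PSPACE = P^A` for every
  class `C` with `C^O ⊆ PSPACE^{O[poly]}` relativisably — for `C = BQP` this is Bernstein–Vazirani's
  relativising `BQP ⊆ PSPACE`): there are `A, Ã` with `BQP^Ã ⊆ BPP^A`; hence *proving `BQP ≠ BPP`
  requires non-algebrizing techniques*. Since `BQPRel` takes a Boolean oracle *language*, access
  to the (field-valued) extension oracle is through its **bit language** `Oracle.bitLanguage`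
  (query the `i`-th answer bit / the answer length), the standard Boolean presentation of a
  function oracle, polynomial-time equivalent to it.
* API: `Oracle.bitLanguage` membership lemmas; the two facts unfold to the negations of
  `IsAlgebrizingInclusion`/`IsAlgebrizingSeparation`-shaped statements
  (`not_isAlgebrizingInclusion_of`, real proof).

## Design notes

* Facts are `def … : Prop` (D-0014) with `[cite:]`; degree bound `1` (multilinear extension) as in
  AW ("for all of these separations `Ã` is simply the multilinear extension of `A`").
* The second fact is a *corollary* of AW Thm 5.2 (`PSPACE^{Ã[poly]} = P^A`) which the library
  cannot state verbatim (no relativised `PSPACE` with polynomial query bound yet); the docstring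
  says so and cites both ingredients.
* Mathlib: nothing on oracles/algebrization; all classes are the library's.

## References

* S. Aaronson, A. Wigderson, *Algebrization: a new barrier in complexity theory*, ACM TOCT 1
  (2009), art. 2 (ECCC TR08-005): Def. 2.3, §1.3, Thm 5.1, Thm 5.2, Thm 5.11.
* E. Bernstein, U. Vazirani, *Quantum complexity theory*, SIAM J. Comput. 26 (1997), §8
  (`BQP ⊆ PSPACE`, relativising).
* L. Babai, L. Fortnow, C. Lund, *Non-deterministic exponential time has two-prover interactive
  protocols*, Comput. Complexity 1 (1991) (multilinear extensions of `PSPACE` languages).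
-/

noncomputable section

namespace Literature.Computability.Complexity

open _root_.Computability Cryptography

/-! ### Boolean presentation of a function oracle -/

/-- The **bit language** of a function oracle `O : {0,1}* → {0,1}*`: on the query
`⟨q, 0 :: bin i⟩` it tells whether the `i`-th bit of the answer `O q` is `1` (bits beyond the
answer read `0`), on `⟨q, 1 :: bin i⟩` whether the answer has more than `i` bits. This is the
standard Boolean oracle polynomial-time equivalent to `O` (answers of the oracles used here have
length polynomial in the query), through which classes relativised to oracle *languages*
(`BQPRel`) access extension oracles. [cite: AaronsonWigderson2009, Def. 2.3] -/
def Oracle.bitLanguage (O : Oracle) : Language Bool :=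
  {w | ∃ (q : List Bool) (i : ℕ),
    (w = boolPair q (false :: encodeNat i) ∧ (O q).getD i false = true) ∨
    (w = boolPair q (true :: encodeNat i) ∧ i < (O q).length)}

/-- Bit queries to the bit language read answer bits. [cite: AaronsonWigderson2009, Def. 2.3] -/
theorem Oracle.boolPair_false_mem_bitLanguage_iff (O : Oracle) (q : List Bool) (i : ℕ) :
    boolPair q (false :: encodeNat i) ∈ O.bitLanguage ↔ (O q).getD i false = true := by
  constructor
  · rintro ⟨q', i', ⟨h, hb⟩ | ⟨h, -⟩⟩
    · have h1 := boolPair_injective (a₁ := (q, _)) (a₂ := (q', _)) h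
      simp only [Prod.mk.injEq, List.cons.injEq, true_and] at h1
      obtain ⟨rfl, h2⟩ := h1
      have : i = i' := by simpa using congrArg decodeNat h2
      subst this
      exact hb
    · have h1 := boolPair_injective (a₁ := (q, _)) (a₂ := (q', _)) h
      simp at h1
  · exact fun h => ⟨q, i, Or.inl ⟨rfl, h⟩⟩

/-- Length queries to the bit language read the answer length. [cite: AaronsonWigderson2009, Def. 2.3] -/
theorem Oracle.boolPair_true_mem_bitLanguage_iff (O : Oracle) (q : List Bool) (i : ℕ) :
    boolPair q (true :: encodeNat i) ∈ O.bitLanguage ↔ i < (O q).length := by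
  constructor
  · rintro ⟨q', i', ⟨h, -⟩ | ⟨h, hb⟩⟩
    · have h1 := boolPair_injective (a₁ := (q, _)) (a₂ := (q', _)) h
      simp at h1
    · have h1 := boolPair_injective (a₁ := (q, _)) (a₂ := (q', _)) h
      simp only [Prod.mk.injEq, List.cons.injEq, true_and] at h1
      obtain ⟨rfl, h2⟩ := h1
      have : i = i' := by simpa using congrArg decodeNat h2
      subst this
      exact hb
  · exact fun h => ⟨q, i, Or.inr ⟨rfl, h⟩⟩

/-! ### The two barriers -/

/-- **Aaronson–Wigderson 2009, Theorem 5.11 (iv)** (algebraic oracle separation of `BQP` from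
`BPP`): there are an oracle language `A` and a multilinear (degree `≤ 1` in each variable)
extension `Ã` of `A` over the prime fields such that `BQP^A ⊄ BPP^Ã`. By AW Def. 2.3 this says:
*proving `BQP ⊆ BPP` (i.e. `BPP = BQP`) requires non-algebrizing techniques* (AW §1.3).
[cite: AaronsonWigderson2009, Thm 5.11 (iv)] -/
def aaronsonWigderson2009_bqp_not_subset_bpp : Prop :=
  ∃ (A : Language Bool) (Ã : ExtensionOracle), Ã.IsExtensionOf A 1 ∧
    ¬ BQPRel A ⊆ BPPRel Ã.toOracle

/-- **Aaronson–Wigderson 2009, the `BQP` instance of the Theorem 5.1/5.2 collapse** (corollary):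
there are an oracle language `A` (any `PSPACE`-complete one) and a multilinear extension `Ã` of
`A` (again `PSPACE`-computable, Babai–Fortnow–Lund) such that `BQP^Ã ⊆ BPP^A`, quantum access
to `Ã` being through its bit language: indeed
`BQP^Ã ⊆ PSPACE^{Ã[poly]} = PSPACE = P^A ⊆ BPP^A` (AW Thm 5.2: `PSPACE^{Ã[poly]} = P^A`;
Bernstein–Vazirani: `BQP^O ⊆ PSPACE^{O[poly]}` relativisably). By AW Def. 2.3: *proving the
separation `BQP ⊄ BPP` (i.e. `BQP ≠ BPP`) requires non-algebrizing techniques*; in particular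
arithmetisation-based interactive-proof techniques do not suffice.
[cite: AaronsonWigderson2009, Thm 5.2 and Def. 2.3] -/
def aaronsonWigderson2009_bqp_subset_bpp_collapse : Prop :=
  ∃ (A : Language Bool) (Ã : ExtensionOracle), Ã.IsExtensionOf A 1 ∧
    BQPRel (Oracle.bitLanguage Ã.toOracle) ⊆ BPPRel (Oracle.ofLanguage A)

/-! ### Relation to the algebrization predicates -/

/-- A single algebraic oracle separation `C^A ⊄ D^Ã` refutes "the inclusion `C ⊆ D` algebrizes"
(AW Def. 2.3, contrapositive; real proof). [cite: AaronsonWigderson2009, Def. 2.3] -/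
theorem not_isAlgebrizingInclusion_of {C D : Oracle → Set (Language Bool)} {A : Language Bool}
    {Ã : ExtensionOracle} {d : ℕ} (hÃ : Ã.IsExtensionOf A d)
    (h : ¬ C (Oracle.ofLanguage A) ⊆ D Ã.toOracle) : ¬ IsAlgebrizingInclusion C D :=
  fun halg => h (halg A Ã d hÃ)

/-- The AW separation fact refutes algebrization of the inclusion `BQP ⊆ BPP`, with `BQP`
relativised through `Oracle.ofLanguage` (the form `IsAlgebrizingInclusion` expects; on
`Oracle.ofLanguage A` we read `BQPRel A`). [cite: AaronsonWigderson2009, Thm 5.11 (iv)] -/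
theorem not_isAlgebrizingInclusion_bqp_bpp (h : aaronsonWigderson2009_bqp_not_subset_bpp)
    {C : Oracle → Set (Language Bool)} (hC : ∀ A : Language Bool, C (Oracle.ofLanguage A) = BQPRel A) :
    ¬ IsAlgebrizingInclusion C BPPRel := by
  obtain ⟨A, Ã, hÃ, hno⟩ := h
  exact not_isAlgebrizingInclusion_of hÃ (by rwa [hC A])

end Literature.Computability.Complexity

end
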